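import Summits.HodgeConjecture.CorCM.PairFlipCompanionCMFieldsHodge
import Summits.HodgeConjecture.CorCM.PairFlipCMFieldsSplitOffHodge
import HarnessLib

/-!
# Generic slots over one totally real field SPLIT OFF: products of arbitrarily many CM abelian varieties of one
# dimension over a common totally real field

COR-CM (cell `pub-hodgecm2`, binder seat `b16` gen 51, count-neutral claim PAIRFLIP-COMPANION, file F7 — CM fields and
abelian varieties; theorems only, no definition, no named fact, no `sorry`).  NEW as stated, hence under `Summits/`.
HONEST FRAMING: unconditional theorems on products of CM abelian varieties; `HC_CM` is neither used nor asserted.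

The n-ary form of F2/F3 (`pairwise_of_pairFlip_compatible`, `pairFlip_compatible_of_ringHom_real`), by the block
criterion of the tree (`isNondegenerateFamily_of_fibers`, as in `PairFlipCMFieldsSplitOffHodge` where the generic slots
were asked to have Galois closures different from each other and not inside the other closures).  SETTING: a finite
family `(K_i; Φ_i)_{i ∈ I}` of CM fields ALL OF ONE DEGREE `2n` over ONE totally real field `F` (`e_i : F → K_i`,
`[K_i:ℚ] = 2[F:ℚ]`), and a set `p ⊆ I` of PAIR-FLIP slots whose fields are pairwise non-isomorphic and non-isomorphic
to the fields outside `p` (`K_i ≇ K_j` for `i ∈ p`, `j ≠ i`).  Then the flips of `K_i` preserve the pairs of every `K_j`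
(F2), so a slot of `p` shares no constituent with any other slot, and:

* §1 **`isNondegenerateFamily_iff_of_pairFlip_slots_of_ringHom_real`** — `(Φ_i)_i` is nondegenerate IFF the sub-family
  OUTSIDE `p` is: generic slots over the common real field split off, whatever their Galois closures.
* §2 **`isNondegenerateFamily_pairFlip_of_ringHom_real`** — ALL slots generic with pairwise non-isomorphic fields over one
  `F` ⟹ nondegenerate (`Hg(∏ A_i) = ∏ Hg(A_i)`); **`hodgeConjectureFor_prod_pairFlip_of_ringHom_real`** — the Hodge
  conjecture with `B• = D•` on every `⨁_{j<N} A_{π j}`, UNCONDITIONALLY, for CM abelian `n`-folds with pairwise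
  non-isomorphic generic CM fields `F(√−α₁), …, F(√−α_r)` over one totally real `F` (e.g. up to four companions
  `F(√−α)`, `F(√−αD)`, `F(√−αN)`, `F(√−αDN)` in ONE Galois closure when `n` is even).
* §3 **`hodgeConjectureFor_prod_of_pairFlip_slots_of_ringHom_real`** — the Hodge conjecture on all products as soon as
  the sub-family outside `p` is nondegenerate.

## References

* [Gordon1999HodgeAVSurvey] B. B. Gordon, *A survey of the Hodge conjecture for abelian varieties*, §3 Theorem, 7.4–7.7,
  10.10.
* [Dodson1984] B. Dodson, *The structure of Galois groups of CM-fields*, Trans. AMS 283 (1984), §1.1, §5.1.2.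
* [MoonenZarhin1999LowDim] B. Moonen, Yu. Zarhin, *Hodge classes on abelian varieties of low dimension*, Math. Ann. 315
  (1999), §3 (3.1).
-/

noncomputable section

open CategoryTheory CategoryTheory.Limits NumberField Module IntermediateField

namespace Summit.HodgeConjecture.CorCM

open Literature.NumberTheory.ComplexMultiplication
open Literature.AlgebraicGeometry.Motives (AbelianVariety CMType)
open Literature.AlgebraicGeometry.HodgeTheory
open Literature.AlgebraicGeometry.ComplexMultiplication (IsCMTypeRealisation isSimple_iff_isPrimitive)
open Literature.AlgebraicGeometry.VanGeemen1994 (hodgeClassSpan)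
open Literature.AlgebraicGeometry.Pohlmann1968
open Literature.Barriers.HodgeConjecture (divisorClassesSpan)

variable {I : Type} {K : I → Type} [∀ i, Field (K i)] [∀ i, NumberField (K i)] [∀ i, IsCMField (K i)] [Fintype I]
  [DecidableEq I] [Nonempty I] {Φ : ∀ i, CMType (K i)} {F : Type} [Field F] [NumberField F] [IsTotallyReal F]

/-! ## §1 Types: generic slots over the common real field split off -/

section Types

/-- **GENERIC SLOTS OVER ONE TOTALLY REAL FIELD SPLIT OFF.**  All `K_i` of degree `2[F:ℚ]` over the totally real `F`;
`p ⊆ I` pair-flip slots with `K_i ≇ K_j` for `i ∈ p`, `j ≠ i`.  Then `(Φ_i)_i` is nondegenerate IFF its sub-family outside `p`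
is (blocks = the single slots of `p`, each nondegenerate and sharing no constituent with any other slot by F2, and the rest).
[cite: Gordon1999HodgeAVSurvey, 7.5–7.7 and 7.6.1] [cite: MoonenZarhin1999LowDim, §3 (3.1)] [cite: Dodson1984, §5.1.2] -/
theorem isNondegenerateFamily_iff_of_pairFlip_slots_of_ringHom_real (p : I → Prop) [DecidablePred p]
    (hflip : ∀ i, p i → ∀ s : K i →+* ℂ, ∃ σ : ℂ ≃+* ℂ, σ • s = (starRingAut : ℂ ≃+* ℂ) • s ∧
      ∀ t : K i →+* ℂ, t ≠ s → t ≠ (starRingAut : ℂ ≃+* ℂ) • s → σ • t = t)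
    (e : ∀ i, F →+* K i) (hF : ∀ i, finrank ℚ (K i) = 2 * finrank ℚ F)
    (hne : ∀ i j, i ≠ j → p i → IsEmpty (K i ≃+* K j)) :
    CMAlgebra.IsNondegenerateFamily Φ ↔
      ((∃ i, ¬ p i) → CMAlgebra.IsNondegenerateFamily (K := fun i : {i // ¬ p i} => K i.1) fun i => Φ i.1) := by
  classical
  refine ⟨fun hΦ hex => isNondegenerateFamily_subtype hΦ (fun i => ¬ p i) hex, fun hrest => ?_⟩
  -- a slot of `p` shares no constituent with any other slot (both orders)
  have hp2 : ∀ i j, i ≠ j → p i →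
      (∀ P : Submodule ℚ ((K i →+* ℂ) → ℚ), P ≤ antiSpan (ℂ ≃+* ℂ) (Φ i).1 →
        (∀ g : ℂ ≃+* ℂ, ∀ f ∈ P, (fun x => f (g • x)) ∈ P) →
        ∀ T : ((K i →+* ℂ) → ℚ) →ₗ[ℚ] ((K j →+* ℂ) → ℚ),
          (∀ g : ℂ ≃+* ℂ, ∀ f ∈ P, T (fun x => f (g • x)) = fun y => T f (g • y)) →
          (∀ f ∈ P, T f ∈ antiSpan (ℂ ≃+* ℂ) (Φ j).1) → (∀ f ∈ P, T f = 0 → f = 0) → P = ⊥) ∧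
      (∀ P : Submodule ℚ ((K j →+* ℂ) → ℚ), P ≤ antiSpan (ℂ ≃+* ℂ) (Φ j).1 →
        (∀ g : ℂ ≃+* ℂ, ∀ f ∈ P, (fun y => f (g • y)) ∈ P) →
        ∀ T' : ((K j →+* ℂ) → ℚ) →ₗ[ℚ] ((K i →+* ℂ) → ℚ),
          (∀ g : ℂ ≃+* ℂ, ∀ f ∈ P, T' (fun y => f (g • y)) = fun x => T' f (g • x)) →
          (∀ f ∈ P, T' f ∈ antiSpan (ℂ ≃+* ℂ) (Φ i).1) → (∀ f ∈ P, T' f = 0 → f = 0) → P = ⊥) :=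
    fun i j hij hi => pairwise_of_pairFlip_compatible (Φ := Φ)
      (pairFlip_compatible_of_ringHom_real (Φ i) (hflip i hi) (e i) (e j) (hF j)) ((hF i).trans (hF j).symm)
      (hne i j hij hi)
  -- blocks: `some i` for a slot `i ∈ p`, `none` for the rest
  let κ : I → Option I := fun i => if p i then some i else none
  have hκp : ∀ i, p i → κ i = some i := fun i hi => by simp only [κ, if_pos hi]
  have hκn : ∀ i, ¬ p i → κ i = none := fun i hi => by simp only [κ, if_neg hi]
  refine isNondegenerateFamily_of_fibers Φ κ (fun i j hij => ?_) (fun c hc => ?_)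
  · have hne' : i ≠ j := by rintro rfl; exact hij rfl
    by_cases hi : p i
    · exact (hp2 i j hne' hi).1
    · by_cases hj : p j
      · exact (hp2 j i (Ne.symm hne') hj).2
      · exact absurd ((hκn i hi).trans (hκn j hj).symm) hij
  · obtain ⟨i₀, hi₀⟩ := hc
    by_cases hp0 : p i₀
    · -- the block of a slot of `p` is the slot itself, nondegenerate by its pair flips
      rw [hκp i₀ hp0] at hi₀
      subst hi₀
      haveI : Nonempty {i // κ i = some i₀} := ⟨⟨i₀, hκp i₀ hp0⟩⟩
      haveI : Subsingleton {i // κ i = some i₀} := ⟨fun a b => Subtype.ext (by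
        have ha := a.2
        have hb := b.2
        by_cases hpa : p a.1
        · by_cases hpb : p b.1
          · rw [hκp _ hpa] at ha; rw [hκp _ hpb] at hb
            exact (Option.some_injective _ ha).trans (Option.some_injective _ hb).symm
          · rw [hκn _ hpb] at hb; exact absurd hb (by simp)
        · rw [hκn _ hpa] at ha; exact absurd ha (by simp))⟩
      refine isNondegenerateFamily_of_subsingleton (K := fun i : {i // κ i = some i₀} => K i.1) (fun i => Φ i.1)
        fun i => ?_
      have hpi : p i.1 := by
        by_contra h
        have := i.2
        rw [hκn _ h] at this
        exact absurd this (by simp)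
      exact (irreducible_and_finrank_eq_of_pairFlip (Φ := Φ) (hflip i.1 hpi)).2.2
    · rw [hκn i₀ hp0] at hi₀
      subst hi₀
      let e' : {i // ¬ p i} ≃ {i // κ i = none} := Equiv.subtypeEquivRight fun i => by
        constructor
        · intro h; exact hκn i h
        · intro h hpi; rw [hκp i hpi] at h; exact absurd h (by simp)
      exact (isNondegenerateFamily_iff_of_equiv (K := fun i : {i // κ i = none} => K i.1) (fun i => Φ i.1) e').1
        (hrest ⟨i₀, hp0⟩)

/-- **ALL SLOTS GENERIC OVER ONE TOTALLY REAL FIELD, PAIRWISE NON-ISOMORPHIC ⟹ NONDEGENERATE.**  Pair-flip CM fields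
`K_i ⊇ e_i(F)` of degree `2[F:ℚ]`, pairwise non-isomorphic: every family of types is nondegenerate — `Hg(∏ A_i) = ∏ Hg(A_i)`,
all of full rank. [cite: Gordon1999HodgeAVSurvey, §3 Theorem and 7.5–7.7] [cite: Dodson1984, §5.1.2] -/
theorem isNondegenerateFamily_pairFlip_of_ringHom_real
    (hflip : ∀ i, ∀ s : K i →+* ℂ, ∃ σ : ℂ ≃+* ℂ, σ • s = (starRingAut : ℂ ≃+* ℂ) • s ∧
      ∀ t : K i →+* ℂ, t ≠ s → t ≠ (starRingAut : ℂ ≃+* ℂ) • s → σ • t = t)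
    (e : ∀ i, F →+* K i) (hF : ∀ i, finrank ℚ (K i) = 2 * finrank ℚ F)
    (hne : ∀ i j, i ≠ j → IsEmpty (K i ≃+* K j)) : CMAlgebra.IsNondegenerateFamily Φ := by
  classical
  exact (isNondegenerateFamily_iff_of_pairFlip_slots_of_ringHom_real (Φ := Φ) (fun _ => True) (fun i _ => hflip i) e hF
    (fun i j hij _ => hne i j hij)).2 fun ⟨i, hi⟩ => absurd trivial hi

end Types

/-! ## §2 Abelian varieties -/

section Geometry

variable {A : I → AbelianVariety ℂ} {ι : ∀ i, 𝓞 (K i) →+* End (A i)}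
  {θ : ∀ i, K i →+* Module.End ℂ (complexBetti (A i).X 1)}

/-- **The Hodge conjecture on every product of CM abelian varieties of one dimension whose CM fields are generic, pairwise
non-isomorphic, over one totally real field** — `B• = D•` on every `⨁_{j<N} A_{π j}` (all `∏ A_i^{k_i}`), UNCONDITIONALLY;
for simple non-isogenous realisations no product carries an exceptional class.
[cite: Gordon1999HodgeAVSurvey, 7.5 and 10.10] [cite: Dodson1984, §5.1.2] -/
theorem hodgeConjectureFor_prod_pairFlip_of_ringHom_real
    (hflip : ∀ i, ∀ s : K i →+* ℂ, ∃ σ : ℂ ≃+* ℂ, σ • s = (starRingAut : ℂ ≃+* ℂ) • s ∧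
      ∀ t : K i →+* ℂ, t ≠ s → t ≠ (starRingAut : ℂ ≃+* ℂ) • s → σ • t = t)
    (e : ∀ i, F →+* K i) (hF : ∀ i, finrank ℚ (K i) = 2 * finrank ℚ F) (hne : ∀ i j, i ≠ j → IsEmpty (K i ≃+* K j))
    (hA : ∀ i, IsCMTypeRealisation (Φ i) (A i) (ι i) (θ i)) {N : ℕ} (π : Fin N → I) :
    HodgeConjectureFor (⨁ fun j : Fin N => A (π j)).dim (⨁ fun j : Fin N => A (π j)).X ∧
      ∀ m : ℕ, hodgeClassSpan (⨁ fun j : Fin N => A (π j)).dim (⨁ fun j : Fin N => A (π j)).X m =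
        divisorClassesSpan (⨁ fun j : Fin N => A (π j)).X (⨁ fun j : Fin N => A (π j)).dim m :=
  have h := isNondegenerateFamily_pairFlip_of_ringHom_real (Φ := Φ) hflip e hF hne
  ⟨h.hodgeConjectureFor_prod hA π, fun m => h.hodgeClassSpan_prod_eq_divisorClassesSpan hA π m⟩

/-- **No exceptional Hodge class on any product** of CM abelian varieties with generic, pairwise non-isomorphic CM fields
of one degree over one totally real field. [cite: Gordon1999HodgeAVSurvey, 7.5 (1) ⟹ (3)] -/
theorem not_exists_exceptional_prod_pairFlip_of_ringHom_real
    (hflip : ∀ i, ∀ s : K i →+* ℂ, ∃ σ : ℂ ≃+* ℂ, σ • s = (starRingAut : ℂ ≃+* ℂ) • s ∧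
      ∀ t : K i →+* ℂ, t ≠ s → t ≠ (starRingAut : ℂ ≃+* ℂ) • s → σ • t = t)
    (e : ∀ i, F →+* K i) (hF : ∀ i, finrank ℚ (K i) = 2 * finrank ℚ F) (hne : ∀ i j, i ≠ j → IsEmpty (K i ≃+* K j))
    (hA : ∀ i, IsCMTypeRealisation (Φ i) (A i) (ι i) (θ i)) :
    ¬ ∃ (N : ℕ) (π : Fin N → I) (m : ℕ) (c : complexBetti (⨁ fun j : Fin N => A (π j)).X (2 * m)),
      IsRationalClass c ∧
      IsOfHodgeType (⨁ fun j : Fin N => A (π j)).dim (⨁ fun j : Fin N => A (π j)).X (2 * m) m m c ∧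
      c ∉ divisorClassesSpan (⨁ fun j : Fin N => A (π j)).X (⨁ fun j : Fin N => A (π j)).dim m := by
  rintro ⟨N, π, m, c, hcQ, hcH, hcD⟩
  have h := isNondegenerateFamily_pairFlip_of_ringHom_real (Φ := Φ) hflip e hF hne
  exact hcD (by
    rw [← h.hodgeClassSpan_prod_eq_divisorClassesSpan hA π m]
    exact Submodule.subset_span ⟨hcQ, hcH⟩)

/-- **The Hodge conjecture on all products as soon as the sub-family outside the generic slots is nondegenerate**: the
generic slots over the common real field (non-isomorphic to every other field of the family) split off, and then
`B• = D•` on every `⨁_{j<N} A_{π j}`, UNCONDITIONALLY. [cite: Gordon1999HodgeAVSurvey, 7.5, 7.6.1 and 10.10] -/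
theorem hodgeConjectureFor_prod_of_pairFlip_slots_of_ringHom_real (p : I → Prop) [DecidablePred p]
    (hflip : ∀ i, p i → ∀ s : K i →+* ℂ, ∃ σ : ℂ ≃+* ℂ, σ • s = (starRingAut : ℂ ≃+* ℂ) • s ∧
      ∀ t : K i →+* ℂ, t ≠ s → t ≠ (starRingAut : ℂ ≃+* ℂ) • s → σ • t = t)
    (e : ∀ i, F →+* K i) (hF : ∀ i, finrank ℚ (K i) = 2 * finrank ℚ F)
    (hne : ∀ i j, i ≠ j → p i → IsEmpty (K i ≃+* K j))
    (hrest : (∃ i, ¬ p i) → CMAlgebra.IsNondegenerateFamily (K := fun i : {i // ¬ p i} => K i.1) fun i => Φ i.1)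
    (hA : ∀ i, IsCMTypeRealisation (Φ i) (A i) (ι i) (θ i)) {N : ℕ} (π : Fin N → I) :
    HodgeConjectureFor (⨁ fun j : Fin N => A (π j)).dim (⨁ fun j : Fin N => A (π j)).X ∧
      ∀ m : ℕ, hodgeClassSpan (⨁ fun j : Fin N => A (π j)).dim (⨁ fun j : Fin N => A (π j)).X m =
        divisorClassesSpan (⨁ fun j : Fin N => A (π j)).X (⨁ fun j : Fin N => A (π j)).dim m :=
  have h := (isNondegenerateFamily_iff_of_pairFlip_slots_of_ringHom_real (Φ := Φ) p hflip e hF hne).2 hrest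
  ⟨h.hodgeConjectureFor_prod hA π, fun m => h.hodgeClassSpan_prod_eq_divisorClassesSpan hA π m⟩

end Geometry

end Summit.HodgeConjecture.CorCM

end
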